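import Literature.Analysis.UnboundedOperators.HeatKernelPoincare
import Mathlib.Analysis.InnerProductSpace.Laplacian
import HarnessLib

/-!
# The Dirichlet form of the Ornstein–Uhlenbeck-type operator `Δ − (2t)⁻¹ x·∇` in `L²(G_t dx)`

Analysis/UnboundedOperators file (all results proved, no definitions, no named facts), completing
the spectral-gap statement behind the named facts
`Literature.Analysis.FluidPDE.GallayWayne2006_thm11` / `GallayMaekawa2016_thm41`. For the
heat-kernel (Gaussian) weight `G_t = heatKernel t` (`∇G_t = −(x/2t)G_t`) and `h ∈ C²(E)` with
`h, Dh, D²h` bounded: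

* `integral_ornsteinUhlenbeck_mul_mul_heatKernel` — **the form identity**
  `∫ (Δh − (2t)⁻¹ Dh(x)[x]) h G_t = −∫ ‖Dh‖² G_t`
  (one integration by parts per direction of an orthonormal basis,
  `integral_mul_fderiv_eq_neg_fderiv_mul_of_integrable`, with `∂ᵢ(hG_t) = ∂ᵢh G_t − (2t)⁻¹⟪x,eᵢ⟫hG_t`,
  then Parseval `∑ᵢ(∂ᵢh)² = ‖Dh‖²` and `∑ᵢ⟪x,eᵢ⟫∂ᵢh = Dh[x]`). The operator `Δ − (2t)⁻¹x·∇` is the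
  conjugate `h ↦ G_t⁻¹ L_t(G_t h)` of `L_t = Δ + (2t)⁻¹x·∇ + n/(2t)`; for `t = 1` on `ℝ²`,
  `L_1 = L = Δ + ½x·∇ + 1` is the linearised vorticity operator of Gallay–Wayne
  (`strainedVorticityOperator 0` of `Analysis/FluidPDE/GaussianVortexPlanar`);
* `integral_sq_mul_heatKernel_le_dirichlet` — **spectral gap**: for mean-zero `h`
  (`∫ hG_t = 0`), `∫ h² G_t ≤ −2t ∫ (Δh − (2t)⁻¹Dh(x)[x]) h G_t`, i.e. `−⟨Lw, w⟩_X ≥ ½‖w‖²_X` on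
  `w = Gh ∈ {∫w = 0}` for `t = 1` (Gallay–Wayne 2005, Prop. 4.1 / App. A; Gallay–Maekawa 2016,
  §2.2), combining the form identity with `sq_integral_heatKernel_poincare`.

## References

* Th. Gallay, C. E. Wayne, Comm. Math. Phys. 255 (2005), Prop. 4.1, App. A; Th. Gallay,
  Y. Maekawa, arXiv:1610.08384, §2.2. D. Bakry, I. Gentil, M. Ledoux, *Analysis and Geometry of
  Markov Diffusion Operators*, §2.7.1 (Ornstein–Uhlenbeck operator). [folklore]
-/

open MeasureTheory Filter Topology Set InnerProductSpace Metric
open scoped Real RealInnerProductSpace Laplacian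

noncomputable section

namespace Literature.Analysis.UnboundedOperators

section DirichletForm

variable {E : Type*} [NormedAddCommGroup E] [InnerProductSpace ℝ E] [FiniteDimensional ℝ E]
  [MeasurableSpace E] [BorelSpace E]

omit [MeasurableSpace E] [BorelSpace E] in
/-- Parseval for a continuous linear functional: `∑ᵢ ℓ(eᵢ)² = ‖ℓ‖²` for an orthonormal basis.
[folklore] -/
theorem sum_sq_apply_orthonormalBasis {ι : Type*} [Fintype ι] (b : OrthonormalBasis ι ℝ E)
    (ℓ : E →L[ℝ] ℝ) : ∑ i, ℓ (b i) ^ 2 = ‖ℓ‖ ^ 2 := by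
  haveI : CompleteSpace E := FiniteDimensional.complete ℝ E
  set g := (InnerProductSpace.toDual ℝ E).symm ℓ with hg
  have hℓ : ∀ v, ℓ v = ⟪g, v⟫ := fun v => by rw [hg, InnerProductSpace.toDual_symm_apply]
  have hn : ‖ℓ‖ = ‖g‖ := by rw [hg, LinearIsometryEquiv.norm_map]
  rw [hn, ← real_inner_self_eq_norm_sq, ← b.sum_inner_mul_inner g g]
  congr 1; funext i
  rw [hℓ, sq, real_inner_comm (b i) g]

omit [FiniteDimensional ℝ E] [MeasurableSpace E] [BorelSpace E] in
/-- `∑ᵢ ⟪x, eᵢ⟫ ℓ(eᵢ) = ℓ(x)` for an orthonormal basis. [folklore] -/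
theorem sum_inner_mul_apply_orthonormalBasis {ι : Type*} [Fintype ι] (b : OrthonormalBasis ι ℝ E)
    (ℓ : E →L[ℝ] ℝ) (x : E) : ∑ i, ⟪x, b i⟫ * ℓ (b i) = ℓ x := by
  conv_rhs => rw [← b.sum_repr' x]
  rw [map_sum]
  congr 1; funext i
  rw [map_smul, smul_eq_mul, real_inner_comm]

omit [MeasurableSpace E] [BorelSpace E] in
/-- The Laplacian as the sum of pure second directional derivatives along an orthonormal basis,
for a `C²` scalar function (scalar case of `Literature.Analysis.FluidPDE.laplacian_eq_sum_fderiv_fderiv`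
in `FluidPDE/WholeSpaceIBP`, kept private here to avoid that import). [folklore] -/
private theorem laplacian_eq_sum_fderiv_fderiv {ι : Type*} [Fintype ι] (b : OrthonormalBasis ι ℝ E)
    {h : E → ℝ} (hh : ContDiff ℝ 2 h) (x : E) :
    Δ h x = ∑ i, fderiv ℝ (fun y => fderiv ℝ h y (b i)) x (b i) := by
  have hd : DifferentiableAt ℝ (fderiv ℝ h) x :=
    ((hh.fderiv_right (m := 1) le_rfl).differentiable one_ne_zero).differentiableAt
  have hkey : ∀ v : E, fderiv ℝ (fun y => fderiv ℝ h y v) x v = fderiv ℝ (fderiv ℝ h) x v v := by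
    intro v
    rw [fderiv_clm_apply hd (differentiableAt_const v)]
    simp
  rw [InnerProductSpace.laplacian_eq_iteratedFDeriv_orthonormalBasis h b]
  simp only [iteratedFDeriv_two_apply, Matrix.cons_val_zero, Matrix.cons_val_one, hkey]

variable {t : ℝ} (ht : 0 < t) {h : E → ℝ} (hh : ContDiff ℝ 2 h) {C₀ C₁ C₂ : ℝ}
  (h0 : ∀ x, ‖h x‖ ≤ C₀) (h1 : ∀ x, ‖fderiv ℝ h x‖ ≤ C₁) (h2 : ∀ x, ‖fderiv ℝ (fderiv ℝ h) x‖ ≤ C₂)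
include ht hh h0 h1 h2

/-- One integration by parts against `h G_t` in the direction `v` (`‖v‖ = 1` not needed):
`∫ h G_t ∂ᵥ∂ᵥh = −∫ (∂ᵥh)² G_t + (2t)⁻¹ ∫ ⟪x,v⟫ h ∂ᵥh G_t`. [folklore] -/
theorem integral_mul_heatKernel_mul_fderiv_fderiv (v : E) :
    ∫ x, h x * heatKernel t x * fderiv ℝ (fun y => fderiv ℝ h y v) x v =
      (-∫ x, fderiv ℝ h x v ^ 2 * heatKernel t x) +
        (2 * t)⁻¹ * ∫ x, ⟪x, v⟫ * h x * fderiv ℝ h x v * heatKernel t x := by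
  have hK := integrable_heatKernel_holds (E := E) ht
  have hKn := integrable_heatKernel_mul_norm (E := E) ht
  have hC₀ : 0 ≤ C₀ := (norm_nonneg _).trans (h0 0)
  have hC₁ : 0 ≤ C₁ := (norm_nonneg _).trans (h1 0)
  have hhc : Continuous h := hh.continuous
  have hhd : Differentiable ℝ h := hh.differentiable two_ne_zero
  have hh1 : ContDiff ℝ 1 (fun y => fderiv ℝ h y v) :=
    (hh.fderiv_right (m := 1) le_rfl).clm_apply contDiff_const
  have hh1c : Continuous (fun y => fderiv ℝ h y v) := hh1.continuous
  have hh1d : Differentiable ℝ (fun y => fderiv ℝ h y v) := hh1.differentiable one_ne_zero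
  have hh2c : Continuous (fun x => fderiv ℝ (fun y => fderiv ℝ h y v) x v) :=
    (hh1.continuous_fderiv one_ne_zero).clm_apply continuous_const
  have hKd : ∀ x, HasFDerivAt (heatKernel (E := E) t) _ x := fun x => hasFDerivAt_heatKernel t x
  -- bounds on the derivatives along `v`
  have hb1 : ∀ x, ‖fderiv ℝ h x v‖ ≤ C₁ * ‖v‖ := fun x =>
    ((fderiv ℝ h x).le_opNorm v).trans (mul_le_mul_of_nonneg_right (h1 x) (norm_nonneg _))
  have hb2 : ∀ x, ‖fderiv ℝ (fun y => fderiv ℝ h y v) x v‖ ≤ C₂ * ‖v‖ * ‖v‖ := by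
    intro x
    have hd : DifferentiableAt ℝ (fderiv ℝ h) x :=
      ((hh.fderiv_right (m := 1) le_rfl).differentiable one_ne_zero).differentiableAt
    rw [fderiv_clm_apply hd (differentiableAt_const v)]
    simp only [fderiv_fun_const, Pi.zero_apply, ContinuousLinearMap.comp_zero, zero_add,
      ContinuousLinearMap.flip_apply]
    calc ‖fderiv ℝ (fderiv ℝ h) x v v‖ ≤ ‖fderiv ℝ (fderiv ℝ h) x v‖ * ‖v‖ :=
          ContinuousLinearMap.le_opNorm _ _
      _ ≤ ‖fderiv ℝ (fderiv ℝ h) x‖ * ‖v‖ * ‖v‖ := by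
          gcongr; exact ContinuousLinearMap.le_opNorm _ _
      _ ≤ C₂ * ‖v‖ * ‖v‖ := by gcongr; exact h2 x
  -- the derivative of `h G_t`
  have hprod : ∀ x, HasFDerivAt (fun y => h y * heatKernel t y)
      (h x • (-(heatKernel t x / (2 * t)) • innerSL ℝ x) + heatKernel t x • fderiv ℝ h x) x :=
    fun x => (hhd x).hasFDerivAt.mul (hKd x)
  have hprod' : ∀ x, fderiv ℝ (fun y => h y * heatKernel t y) x v =
      fderiv ℝ h x v * heatKernel t x - (2 * t)⁻¹ * (⟪x, v⟫ * h x * heatKernel t x) := by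
    intro x
    rw [(hprod x).fderiv]
    simp only [FunLike.coe_add, Pi.add_apply, FunLike.coe_smul, Pi.smul_apply,
      innerSL_apply_apply, smul_eq_mul]
    ring
  -- integrability of the three products (domination by `G_t` and `‖x‖G_t`)
  have hmeas1 : AEStronglyMeasurable (fun x => fderiv ℝ (fun y => h y * heatKernel t y) x v *
      fderiv ℝ h x v) volume := by
    simp_rw [hprod']
    exact (((hh1c.mul (continuous_heatKernel t)).sub (continuous_const.mul
      (((continuous_id.inner continuous_const).mul hhc).mul (continuous_heatKernel t)))).mul
      hh1c).aestronglyMeasurable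
  have i1 : Integrable fun x => fderiv ℝ (fun y => h y * heatKernel t y) x v * fderiv ℝ h x v := by
    refine Integrable.mono' ((hK.const_mul (C₁ * ‖v‖ * (C₁ * ‖v‖))).add
      (hKn.const_mul ((2 * t)⁻¹ * ‖v‖ * C₀ * (C₁ * ‖v‖)))) hmeas1 (Eventually.of_forall fun x => ?_)
    rw [hprod', Pi.add_apply, sub_mul, norm_sub_rev]
    refine (norm_sub_le _ _).trans ?_
    rw [add_comm]
    gcongr
    · have hKx := (heatKernel_pos ht x).le
      rw [norm_mul, norm_mul, Real.norm_of_nonneg hKx]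
      calc ‖fderiv ℝ h x v‖ * heatKernel t x * ‖fderiv ℝ h x v‖
          ≤ C₁ * ‖v‖ * heatKernel t x * (C₁ * ‖v‖) :=
            mul_le_mul (mul_le_mul_of_nonneg_right (hb1 x) hKx) (hb1 x) (norm_nonneg _)
              (mul_nonneg (mul_nonneg hC₁ (norm_nonneg _)) hKx)
        _ = C₁ * ‖v‖ * (C₁ * ‖v‖) * heatKernel t x := by ring
    · have hKx := (heatKernel_pos ht x).le
      rw [norm_mul, norm_mul, norm_mul, norm_mul, Real.norm_of_nonneg hKx,
        Real.norm_of_nonneg (by positivity : (0 : ℝ) ≤ (2 * t)⁻¹)]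
      have hin : ‖⟪x, v⟫‖ * ‖h x‖ * heatKernel t x ≤ ‖x‖ * ‖v‖ * C₀ * heatKernel t x :=
        mul_le_mul_of_nonneg_right (mul_le_mul (norm_inner_le_norm x v) (h0 x) (norm_nonneg _)
          (by positivity)) hKx
      calc (2 * t)⁻¹ * (‖⟪x, v⟫‖ * ‖h x‖ * heatKernel t x) * ‖fderiv ℝ h x v‖
          ≤ (2 * t)⁻¹ * (‖x‖ * ‖v‖ * C₀ * heatKernel t x) * (C₁ * ‖v‖) :=
            mul_le_mul (mul_le_mul_of_nonneg_left hin (by positivity)) (hb1 x) (norm_nonneg _)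
              (mul_nonneg (by positivity) (mul_nonneg (mul_nonneg (by positivity) hC₀) hKx))
        _ = (2 * t)⁻¹ * ‖v‖ * C₀ * (C₁ * ‖v‖) * (heatKernel t x * ‖x‖) := by ring
  have i2 : Integrable fun x => h x * heatKernel t x *
      fderiv ℝ (fun y => fderiv ℝ h y v) x v := by
    have : (fun x => h x * heatKernel t x * fderiv ℝ (fun y => fderiv ℝ h y v) x v) =
        fun x => (h x * fderiv ℝ (fun y => fderiv ℝ h y v) x v) * heatKernel t x := by
      funext x; ring
    rw [this]
    exact hK.bdd_mul (hhc.mul hh2c).aestronglyMeasurable (Eventually.of_forall fun x => by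
      rw [norm_mul]; exact mul_le_mul (h0 x) (hb2 x) (norm_nonneg _) hC₀)
  have i3 : Integrable fun x => h x * heatKernel t x * fderiv ℝ h x v := by
    have : (fun x => h x * heatKernel t x * fderiv ℝ h x v) =
        fun x => (h x * fderiv ℝ h x v) * heatKernel t x := by funext x; ring
    rw [this]
    exact hK.bdd_mul (hhc.mul hh1c).aestronglyMeasurable (Eventually.of_forall fun x => by
      rw [norm_mul]; exact mul_le_mul (h0 x) (hb1 x) (norm_nonneg _) hC₀)
  -- integration by parts
  have hibp := integral_mul_fderiv_eq_neg_fderiv_mul_of_integrable i1 i2 i3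
    (fun x _ => (hprod x).differentiableAt) (fun x _ => hh1d x)
  rw [hibp]
  simp_rw [hprod', sub_mul]
  have ia : Integrable fun x => fderiv ℝ h x v * heatKernel t x * fderiv ℝ h x v := by
    have : (fun x => fderiv ℝ h x v * heatKernel t x * fderiv ℝ h x v) =
        fun x => (fderiv ℝ h x v * fderiv ℝ h x v) * heatKernel t x := by funext x; ring
    rw [this]
    exact hK.bdd_mul (hh1c.mul hh1c).aestronglyMeasurable (Eventually.of_forall fun x => by
      rw [norm_mul]; exact mul_le_mul (hb1 x) (hb1 x) (norm_nonneg _) (by positivity))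
  have ib : Integrable fun x => (2 * t)⁻¹ * (⟪x, v⟫ * h x * heatKernel t x) * fderiv ℝ h x v := by
    refine Integrable.mono' (hKn.const_mul ((2 * t)⁻¹ * ‖v‖ * C₀ * (C₁ * ‖v‖)))
      ((continuous_const.mul (((continuous_id.inner continuous_const).mul hhc).mul
        (continuous_heatKernel t))).mul hh1c).aestronglyMeasurable
      (Eventually.of_forall fun x => ?_)
    have hKx := (heatKernel_pos ht x).le
    rw [norm_mul, norm_mul, norm_mul, norm_mul, Real.norm_of_nonneg hKx,
      Real.norm_of_nonneg (by positivity : (0 : ℝ) ≤ (2 * t)⁻¹)]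
    have hin : ‖⟪x, v⟫‖ * ‖h x‖ * heatKernel t x ≤ ‖x‖ * ‖v‖ * C₀ * heatKernel t x :=
      mul_le_mul_of_nonneg_right (mul_le_mul (norm_inner_le_norm x v) (h0 x) (norm_nonneg _)
        (by positivity)) hKx
    calc (2 * t)⁻¹ * (‖⟪x, v⟫‖ * ‖h x‖ * heatKernel t x) * ‖fderiv ℝ h x v‖
        ≤ (2 * t)⁻¹ * (‖x‖ * ‖v‖ * C₀ * heatKernel t x) * (C₁ * ‖v‖) :=
          mul_le_mul (mul_le_mul_of_nonneg_left hin (by positivity)) (hb1 x) (norm_nonneg _)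
            (mul_nonneg (by positivity) (mul_nonneg (mul_nonneg (by positivity) hC₀) hKx))
      _ = (2 * t)⁻¹ * ‖v‖ * C₀ * (C₁ * ‖v‖) * (heatKernel t x * ‖x‖) := by ring
  rw [integral_sub ia ib, neg_sub, sub_eq_neg_add, ← integral_const_mul]
  congr 1
  · congr 1
    refine integral_congr_ae (Eventually.of_forall fun x => ?_)
    ring
  · refine integral_congr_ae (Eventually.of_forall fun x => ?_)
    ring

/-- **The Dirichlet-form identity** for the conjugated operator `Δ − (2t)⁻¹ x·∇` in
`L²(G_t dx)`: for `h ∈ C²(E)` with `h, Dh, D²h` bounded and `0 < t`,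
`∫ (Δh − (2t)⁻¹ Dh(x)[x]) h G_t = −∫ ‖Dh‖² G_t`. For `t = 1`, `G_1 = G` on `ℝ²`, this is
`⟨L w, w⟩_{L²(G⁻¹)} = −∫‖∇h‖²G` for `w = Gh`, `L = Δ + ½x·∇ + 1` (Gallay–Wayne). [folklore] -/
theorem integral_ornsteinUhlenbeck_mul_mul_heatKernel :
    ∫ x, (Δ h x - (2 * t)⁻¹ * fderiv ℝ h x x) * h x * heatKernel t x =
      -∫ x, ‖fderiv ℝ h x‖ ^ 2 * heatKernel t x := by
  set b := stdOrthonormalBasis ℝ E with hb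
  have hK := integrable_heatKernel_holds (E := E) ht
  have hC₀ : 0 ≤ C₀ := (norm_nonneg _).trans (h0 0)
  have hhc : Continuous h := hh.continuous
  have hh1c : ∀ v, Continuous (fun y => fderiv ℝ h y v) := fun v =>
    ((hh.fderiv_right (m := 1) le_rfl).clm_apply contDiff_const).continuous
  have hh2c : ∀ v, Continuous (fun x => fderiv ℝ (fun y => fderiv ℝ h y v) x v) := fun v =>
    (((hh.fderiv_right (m := 1) le_rfl).clm_apply contDiff_const).continuous_fderiv
      one_ne_zero).clm_apply continuous_const
  -- pointwise expansion of the integrand along the basis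
  have hpt : ∀ x, (Δ h x - (2 * t)⁻¹ * fderiv ℝ h x x) * h x * heatKernel t x =
      ∑ i, h x * heatKernel t x * fderiv ℝ (fun y => fderiv ℝ h y (b i)) x (b i) -
        ∑ i, (2 * t)⁻¹ * (⟪x, b i⟫ * h x * fderiv ℝ h x (b i) * heatKernel t x) := by
    intro x
    rw [laplacian_eq_sum_fderiv_fderiv b hh, ← sum_inner_mul_apply_orthonormalBasis b (fderiv ℝ h x) x,
      Finset.mul_sum, sub_mul, sub_mul, Finset.sum_mul, Finset.sum_mul, Finset.sum_mul,
      Finset.sum_mul]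
    congr 1 <;> refine Finset.sum_congr rfl fun i _ => ?_ <;> ring
  simp_rw [hpt]
  -- integrability of the summands
  have iA : ∀ i, Integrable fun x => h x * heatKernel t x *
      fderiv ℝ (fun y => fderiv ℝ h y (b i)) x (b i) := by
    intro i
    have hb2 : ∀ x, ‖fderiv ℝ (fun y => fderiv ℝ h y (b i)) x (b i)‖ ≤ C₂ * ‖b i‖ * ‖b i‖ := by
      intro x
      have hd : DifferentiableAt ℝ (fderiv ℝ h) x :=
        ((hh.fderiv_right (m := 1) le_rfl).differentiable one_ne_zero).differentiableAt
      rw [fderiv_clm_apply hd (differentiableAt_const _)]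
      simp only [fderiv_fun_const, Pi.zero_apply, ContinuousLinearMap.comp_zero, zero_add,
        ContinuousLinearMap.flip_apply]
      calc ‖fderiv ℝ (fderiv ℝ h) x (b i) (b i)‖ ≤ ‖fderiv ℝ (fderiv ℝ h) x (b i)‖ * ‖b i‖ :=
            ContinuousLinearMap.le_opNorm _ _
        _ ≤ ‖fderiv ℝ (fderiv ℝ h) x‖ * ‖b i‖ * ‖b i‖ := by
            gcongr; exact ContinuousLinearMap.le_opNorm _ _
        _ ≤ C₂ * ‖b i‖ * ‖b i‖ := by gcongr; exact h2 x
    have : (fun x => h x * heatKernel t x * fderiv ℝ (fun y => fderiv ℝ h y (b i)) x (b i)) =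
        fun x => (h x * fderiv ℝ (fun y => fderiv ℝ h y (b i)) x (b i)) * heatKernel t x := by
      funext x; ring
    rw [this]
    exact hK.bdd_mul (hhc.mul (hh2c _)).aestronglyMeasurable (Eventually.of_forall fun x => by
      rw [norm_mul]; exact mul_le_mul (h0 x) (hb2 x) (norm_nonneg _) hC₀)
  have iB : ∀ i, Integrable fun x =>
      (2 * t)⁻¹ * (⟪x, b i⟫ * h x * fderiv ℝ h x (b i) * heatKernel t x) := by
    intro i
    have hb1 : ∀ x, ‖fderiv ℝ h x (b i)‖ ≤ C₁ * ‖b i‖ := fun x =>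
      ((fderiv ℝ h x).le_opNorm _).trans (mul_le_mul_of_nonneg_right (h1 x) (norm_nonneg _))
    refine Integrable.mono' ((integrable_heatKernel_mul_norm ht).const_mul
      ((2 * t)⁻¹ * (‖b i‖ * C₀ * (C₁ * ‖b i‖))))
      (continuous_const.mul ((((continuous_id.inner continuous_const).mul hhc).mul (hh1c _)).mul
        (continuous_heatKernel t))).aestronglyMeasurable (Eventually.of_forall fun x => ?_)
    have hKx := (heatKernel_pos ht x).le
    have hC₁ : 0 ≤ C₁ := (norm_nonneg _).trans (h1 0)
    rw [norm_mul, norm_mul, norm_mul, norm_mul, Real.norm_of_nonneg hKx,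
      Real.norm_of_nonneg (by positivity : (0 : ℝ) ≤ (2 * t)⁻¹)]
    have hin : ‖⟪x, b i⟫‖ * ‖h x‖ * ‖fderiv ℝ h x (b i)‖ ≤ ‖x‖ * ‖b i‖ * C₀ * (C₁ * ‖b i‖) :=
      mul_le_mul (mul_le_mul (norm_inner_le_norm x (b i)) (h0 x) (norm_nonneg _) (by positivity))
        (hb1 x) (norm_nonneg _) (mul_nonneg (by positivity) hC₀)
    calc (2 * t)⁻¹ * (‖⟪x, b i⟫‖ * ‖h x‖ * ‖fderiv ℝ h x (b i)‖ * heatKernel t x)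
        ≤ (2 * t)⁻¹ * (‖x‖ * ‖b i‖ * C₀ * (C₁ * ‖b i‖) * heatKernel t x) :=
          mul_le_mul_of_nonneg_left (mul_le_mul_of_nonneg_right hin hKx) (by positivity)
      _ = (2 * t)⁻¹ * (‖b i‖ * C₀ * (C₁ * ‖b i‖)) * (heatKernel t x * ‖x‖) := by ring
  have iC : ∀ i, Integrable fun x => fderiv ℝ h x (b i) ^ 2 * heatKernel t x := by
    intro i
    have hb1 : ∀ x, ‖fderiv ℝ h x (b i)‖ ≤ C₁ * ‖b i‖ := fun x =>
      ((fderiv ℝ h x).le_opNorm _).trans (mul_le_mul_of_nonneg_right (h1 x) (norm_nonneg _))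
    exact hK.bdd_mul ((hh1c _).pow 2).aestronglyMeasurable (Eventually.of_forall fun x => by
      rw [norm_pow]; exact pow_le_pow_left₀ (norm_nonneg _) (hb1 x) 2)
  rw [integral_sub (integrable_finsetSum _ fun i _ => iA i)
    (integrable_finsetSum _ fun i _ => iB i), integral_finsetSum _ (fun i _ => iA i),
    integral_finsetSum _ (fun i _ => iB i)]
  simp_rw [integral_mul_heatKernel_mul_fderiv_fderiv ht hh h0 h1 h2, integral_const_mul]
  rw [Finset.sum_add_distrib, ← Finset.mul_sum, add_sub_cancel_right, Finset.sum_neg_distrib,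
    ← integral_finsetSum _ (fun i _ => iC i)]
  congr 1
  refine integral_congr_ae (Eventually.of_forall fun x => ?_)
  simp only
  rw [← Finset.sum_mul, sum_sq_apply_orthonormalBasis b (fderiv ℝ h x)]

/-- **Spectral gap of `Δ − (2t)⁻¹x·∇` in `L²(G_t dx)`** (equivalently of
`L = Δ + ½x·∇ + 1` in `L²(G⁻¹dx)` on mean-zero vorticities for `t = 1`, Gallay–Wayne 2005,
Prop. 4.1 / App. A): for `h ∈ C²(E)` with `h, Dh, D²h` bounded and `∫ h G_t = 0`,
`∫ h² G_t ≤ −2t ∫ (Δh − (2t)⁻¹Dh(x)[x]) h G_t`. [folklore] -/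
theorem integral_sq_mul_heatKernel_le_dirichlet (hmean : ∫ x, h x * heatKernel t x = 0) :
    ∫ x, h x ^ 2 * heatKernel t x ≤
      -(2 * t) * ∫ x, (Δ h x - (2 * t)⁻¹ * fderiv ℝ h x x) * h x * heatKernel t x := by
  have hP := sq_integral_heatKernel_poincare ht (hh.of_le one_le_two) h0 h1
  rw [hmean] at hP
  rw [integral_ornsteinUhlenbeck_mul_mul_heatKernel ht hh h0 h1 h2]
  simp only [ne_eq, OfNat.ofNat_ne_zero, not_false_eq_true, zero_pow, sub_zero] at hP
  linarith

end DirichletForm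

end Literature.Analysis.UnboundedOperators
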